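import Literature.FieldTheory.Separability.PDegreeSeparablyGenerated
import Mathlib.RingTheory.Localization.AtPrime.Basic
import HarnessLib

/-!
# Steer `c = 3` book, kernel fact (K-rank): THE RESIDUE FIELD OF A GEOMETRIC CHART OF POSITIVE RELATIVE DIMENSION IS NOT PERFECT

OURS (campaign res-hironaka, rung L ★L-G4, slot W4.1, crux `Steer` stmt-ResolutionOfSingularities-16345; res-L0-w41-plan-1 RULINGS 144 (iv) /
149b (i), kernel fact (K-rank) of res-L0-w41-strat-2's STRAT2-MEMO-1 §17.1 / `GeomChainWords.lean` 2bf798d920f2cc81; res-L0-w41-stub-3 g7; replaces the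
role of no printed item; NOT a statement of the manuscript under review [claim: Hironaka2017, status: under-review]; AI review is weaker than expert
review). Theses-free, definition-free. Consumer: strat-2's `GeomChain.not_forall_perfect_of_geom (hK : GeomChartResidueImperfect p)` — the binder `hK`
is `geomChartResidueImperfect_holds p` (the statement below is the body of `def GeomChartResidueImperfect` with `IsGeomChart A Q S` unfolded, so the
term closes the binder by `δ`-reduction); it kills the residually-PERFECT branch `hG3` on every geometric `c = 3` chain of the T-line.

Mathematics. A GEOMETRIC CHART is a local subring `S ⊆ L` with `z ∈ S ↔ z = a / b`, `a, b ∈ A`, `b ∉ Q`, for a finitely generated subalgebra `A`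
of `L` over a PERFECT field `k` of characteristic `p` and a prime `Q` of `A`; "positive relative dimension" = `Q < Q'` for some prime `Q'`. Then
* `nonempty_residueField_ringEquiv` — `S` is the localisation `A_Q` (`IsLocalization.AtPrime S Q` for the inclusion `A → S`), so `κ(S) ≃ κ(Q) = Frac(A ⧸ Q)`;
* `one_le_ringKrullDim_quotient` — `Q < Q'` gives `dim (A ⧸ Q) ≥ 1`;
* the tree's `Literature.FieldTheory.Separability.finrank_frobenius_residueField_eq_pow` (Matsumura Thm. 26.5 with Thm. 5.6) gives `[κ(Q) : κ(Q)^p] = p ^ dim (A ⧸ Q) ≥ p`,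
  whereas a perfect field has `[K : K^p] = 1` (`finrank_frobenius_fieldRange_eq_one_of_perfectField`);
* `geomChartResidueImperfect_holds` — hence `κ(S)` is NOT perfect. [cite: Matsumura1987, Thm. 26.5; Thm. 5.6] [folklore]
-/

noncomputable section

-- single-problem summit: the doubled namespace component `ResolutionOfSingularities` is forced
set_option linter.dupNamespace false

namespace Summit.ResolutionOfSingularities.ResolutionOfSingularities.Theorems.SwitchingDichotomy.GeomChain

open IsLocalRing

variable {k L : Type} [Field k] [Field L] [Algebra k L]

/-- In a geometric chart `S = A_Q ⊆ L` every element of `A` lies in `S` (`a = a / 1` and `1 ∉ Q`). [folklore] -/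
theorem coe_mem_of_chart (A : Subalgebra k L) (Q : Ideal A) (hQ : Q ≠ ⊤) (S : Subring L)
    (hS : ∀ z : L, z ∈ S ↔ ∃ a b : A, b ∉ Q ∧ z = (a : L) / (b : L)) (a : A) : (a : L) ∈ S :=
  (hS a).mpr ⟨a, 1, fun h => hQ ((Ideal.eq_top_iff_one Q).mpr h), by simp⟩

/-- An element of the subalgebra `A ⊆ L` outside an ideal `Q` is non-zero in `L`. [folklore] -/
theorem coe_ne_zero_of_not_mem (A : Subalgebra k L) (Q : Ideal A) {b : A} (hb : b ∉ Q) : (b : L) ≠ 0 :=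
  fun h => hb (by rw [ZeroMemClass.coe_eq_zero.mp h]; exact Q.zero_mem)

/-- **A geometric chart is the localisation `A_Q`; its residue field is `κ(Q) = Frac(A ⧸ Q)`.** For the inclusion `A → S` the chart
condition `z ∈ S ↔ z = a / b, b ∉ Q` is exactly `IsLocalization.AtPrime S Q` (units: `1 / b ∈ S`; surjectivity: `z · b = a`; injectivity is
free inside the field `L`), so `S ≃ₐ[A] A_Q` (`IsLocalization.algEquiv`) and the residue fields agree (`IsLocalRing.ResidueField.mapEquiv`).
[folklore] -/
theorem nonempty_residueField_ringEquiv (A : Subalgebra k L) (Q : Ideal A) [hQ : Q.IsPrime] (S : Subring L)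
    [IsLocalRing S] (hS : ∀ z : L, z ∈ S ↔ ∃ a b : A, b ∉ Q ∧ z = (a : L) / (b : L)) :
    Nonempty (ResidueField S ≃+* Q.ResidueField) := by
  have hAS : ∀ a : A, (a : L) ∈ S := coe_mem_of_chart A Q hQ.ne_top S hS
  let φ : A →+* S :=
    { toFun := fun a => ⟨(a : L), hAS a⟩
      map_one' := Subtype.ext (by simp)
      map_mul' := fun a b => Subtype.ext (by simp)
      map_zero' := Subtype.ext (by simp)
      map_add' := fun a b => Subtype.ext (by simp) }
  letI : Algebra A S := φ.toAlgebra
  have hφ : ∀ a : A, ((algebraMap A S a : S) : L) = (a : L) := fun a => rfl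
  haveI : IsLocalization.AtPrime S Q := by
    refine (isLocalization_iff _ _).mpr ⟨?_, ?_, ?_⟩
    · rintro ⟨y, hy⟩
      have hy' : y ∉ Q := Ideal.mem_primeCompl_iff.mp hy
      have hy0 : (y : L) ≠ 0 := coe_ne_zero_of_not_mem A Q hy'
      have hinv : (y : L)⁻¹ ∈ S := (hS _).mpr ⟨1, y, hy', by simp⟩
      refine IsUnit.of_mul_eq_one ⟨(y : L)⁻¹, hinv⟩ (Subtype.ext ?_)
      simp only [Subring.coe_mul, hφ, Subring.coe_one]
      exact mul_inv_cancel₀ hy0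
    · intro z
      obtain ⟨a, b, hb, hz⟩ := (hS z).mp z.2
      refine ⟨(a, ⟨b, Ideal.mem_primeCompl_iff.mpr hb⟩), Subtype.ext ?_⟩
      simp only [Subring.coe_mul, hφ]
      rw [hz, div_mul_cancel₀ _ (coe_ne_zero_of_not_mem A Q hb)]
    · intro x y hxy
      refine ⟨1, ?_⟩
      have hxy' : (x : L) = (y : L) := by simpa [hφ] using congrArg (fun s : S => (s : L)) hxy
      rw [Subtype.ext hxy']
  exact ⟨IsLocalRing.ResidueField.mapEquiv
    (IsLocalization.algEquiv Q.primeCompl S (Localization.AtPrime Q)).toRingEquiv⟩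

/-- **A strict chain of primes `Q < Q'` gives `dim (A ⧸ Q) ≥ 1`**: `⊥ < Q' / Q` is a chain of primes of length one in the domain `A ⧸ Q`.
[folklore] -/
theorem one_le_ringKrullDim_quotient {A : Type*} [CommRing A] {Q Q' : Ideal A} [Q.IsPrime] (hQ' : Q'.IsPrime)
    (hlt : Q < Q') : 1 ≤ ringKrullDim (A ⧸ Q) := by
  haveI : (Q'.map (Ideal.Quotient.mk Q)).IsPrime :=
    Ideal.map_isPrime_of_surjective Ideal.Quotient.mk_surjective (by rw [Ideal.mk_ker]; exact hlt.le)
  have hne : Q'.map (Ideal.Quotient.mk Q) ≠ ⊥ := by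
    rw [Ne, Ideal.map_eq_bot_iff_le_ker, Ideal.mk_ker]
    exact not_le_of_gt hlt
  rw [ringKrullDim, Order.one_le_krullDim_iff]
  exact ⟨⟨⊥, Ideal.isPrime_bot⟩, ⟨_, this⟩, (PrimeSpectrum.asIdeal_lt_asIdeal _ _).mp (bot_lt_iff_ne_bot.mpr hne)⟩

/-- **A perfect field is its own `p`-th-power subfield: `[K : K^p] = 1`.** (`K^p = (frobenius K p).fieldRange`; the inclusion `K^p → K`
is bijective when Frobenius is surjective.) [folklore] -/
theorem finrank_frobenius_fieldRange_eq_one_of_perfectField (p : ℕ) [Fact p.Prime] (K : Type*) [Field K] [CharP K p]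
    [PerfectField K] : Module.finrank (frobenius K p).fieldRange K = 1 := by
  haveI : ExpChar K p := ExpChar.prime Fact.out
  haveI : PerfectRing K p := PerfectField.toPerfectRing p
  refine Module.finrank_of_bijective_algebraMap ⟨fun a b h => Subtype.ext h, fun y => ?_⟩
  obtain ⟨x, hx⟩ := surjective_frobenius K p y
  exact ⟨⟨y, RingHom.mem_fieldRange.mpr ⟨x, hx⟩⟩, rfl⟩

/-- **(K-rank) `GeomChartResidueImperfect p` HOLDS for every `p`** (res-L0-w41-strat-2's kernel fact, STRAT2-MEMO-1 §17.1; the statement is the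
body of `def GeomChartResidueImperfect` of `GeomChainWords.lean` 2bf798d920f2cc81 with `IsGeomChart A Q S` unfolded, VERBATIM otherwise):
the residue field of a geometric chart of positive relative dimension over a perfect field of characteristic `p` is NOT perfect — it is
`κ(Q) = Frac(A ⧸ Q)` (`nonempty_residueField_ringEquiv`), finitely generated over `k` of transcendence degree `dim (A ⧸ Q) ≥ 1`
(`one_le_ringKrullDim_quotient`), so `[κ : κ^p] = p ^ dim (A ⧸ Q) ≥ p` by the tree's `finrank_frobenius_residueField_eq_pow`
(Matsumura Thm. 26.5 + Thm. 5.6), while a perfect field has `[κ : κ^p] = 1`. OURS; replaces the role of no printed item; NOT a statement of the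
manuscript under review. [cite: Matsumura1987, Thm. 26.5; Thm. 5.6] [folklore] -/
theorem geomChartResidueImperfect_holds (p : ℕ) :
    ∀ (k L : Type) [Field k] [PerfectField k] [CharP k p] [Field L] [Algebra k L], p.Prime →
    ∀ (A : Subalgebra k L) (Q : Ideal A) (S : Subring L) [IsLocalRing S],
      A.FG → Q.IsPrime → (∃ Q' : Ideal A, Q'.IsPrime ∧ Q < Q') →
      (∀ z : L, z ∈ S ↔ ∃ a b : A, b ∉ Q ∧ z = (a : L) / (b : L)) →
      ¬ PerfectField (ResidueField S) := by
  intro k L _ _ _ _ _ hp A Q S _ hA hQ hQ' hS hperf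
  obtain ⟨Q', hQ'p, hlt⟩ := hQ'
  haveI : Fact p.Prime := ⟨hp⟩
  haveI : Q.IsPrime := hQ
  haveI : Algebra.FiniteType k A := (Subalgebra.fg_iff_finiteType A).mp hA
  -- the residue field of the chart is `κ(Q)`
  obtain ⟨e⟩ := nonempty_residueField_ringEquiv A Q S hS
  -- characteristic `p` everywhere
  haveI : CharP Q.ResidueField p :=
    charP_of_injective_algebraMap (algebraMap k Q.ResidueField).injective p
  haveI : CharP (ResidueField S) p := e.toRingHom.charP e.injective p
  -- `κ(S)` perfect ⇒ `κ(Q)` perfect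
  haveI : ExpChar (ResidueField S) p := ExpChar.prime hp
  haveI : PerfectRing (ResidueField S) p := PerfectField.toPerfectRing p
  haveI : PerfectField Q.ResidueField := by
    haveI : ExpChar Q.ResidueField p := ExpChar.prime hp
    haveI : PerfectRing Q.ResidueField p := PerfectRing.ofSurjective _ p fun y => by
      obtain ⟨x, hx⟩ := surjective_frobenius (ResidueField S) p (e.symm y)
      have hx' : x ^ p = e.symm y := by rw [← frobenius_def]; exact hx
      refine ⟨e x, ?_⟩
      rw [frobenius_def, ← map_pow, hx', RingEquiv.apply_symm_apply]
    exact PerfectRing.toPerfectField _ p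
  -- `dim (A ⧸ Q) = d ≥ 1`
  haveI : IsDomain (A ⧸ Q) := Ideal.Quotient.isDomain Q
  obtain ⟨d, hd, -⟩ := Literature.RingTheory.KrullDimension.exists_ringKrullDim_eq_and_trdeg_eq k (A ⧸ Q)
  have h1 : (1 : WithBot ℕ∞) ≤ d := hd ▸ one_le_ringKrullDim_quotient hQ'p hlt
  have hd0 : d ≠ 0 := by
    intro h0
    rw [h0] at h1
    exact absurd h1 (by decide)
  -- `[κ(Q) : κ(Q)^p] = p ^ d` versus `= 1`
  have hpd := Literature.FieldTheory.Separability.finrank_frobenius_residueField_eq_pow p (k := k) Q hd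
  have hone := finrank_frobenius_fieldRange_eq_one_of_perfectField p Q.ResidueField
  rw [hpd] at hone
  exact (lt_of_lt_of_le hp.one_lt (Nat.le_self_pow hd0 p)).ne' hone

end Summit.ResolutionOfSingularities.ResolutionOfSingularities.Theorems.SwitchingDichotomy.GeomChain

end
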